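import Summits.QuantumFields.YangMills.Theorems.AlphaInputsT3ACv3NewtonLiftFlatLinearisationAllL
import Summits.QuantumFields.YangMills.Theorems.AlphaInputsT3ACv3NewtonDefectMap
import Summits.QuantumFields.YangMills.Theorems.AlphaInputsT3ACv3AvgIterLocality
import Summits.QuantumFields.YangMills.Theorems.AlphaInputsT3ACv3LinearLiftSupport
import HarnessLib

/-!
# `AlphaInputsT3ACv3NewtonLiftFramedLinearisation` — STRATEGY B for 2′, the (FL) row under OWNER RULING g24-№4, residual (r1-T): **HYPOTHESIS (i) OF THE NEWTON SHELL IN A LOCAL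
# GAUGE** — the two-field linearisation of the log-defect `Φ(a)(c) = log(avg^k(e^{a}U₀)(c)·V(c)*)` at a background that is flat ONLY IN A STENCIL GAUGE `σ` around the coarse
# bond `c`, against the FRAMED linearised average `T_σ(a)(c) := h₀*·Q^{(k)}(σ a σ*)(c)·h₀`, `h₀ = σ^{(k)}(c₋)` — lane `pub-balaban3d` ∕ cell `ym3-torus`, seat `ym-ust-19936-w4` (g2)

WHY (cell `ym3-torus` 2026-08-28: ★★OWNER g25 02:16:33Z∕02:29:28Z «(r1-T)∕(r1-shell) → ★w4»; ★w1-19936 g2 LEAD memo v3 §2 «(r1-T) = R3 in the gauge σ + locality (r4) +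
`mlog_defect_gaugeAct`»).  The flat rows `NewtonLiftFlat.norm_mlogDefect_sub_sub_linAvgIterM_le(_allL)` (this seat, g0) ask the background to be η-flat on the WHOLE torus; in the
regional execution of `hLift` the candidate `U₀` is never globally near `1` — the START ((r1-σ), ★w2 g2) supplies, per constrained coarse bond `c`, a fine gauge `σ = σ_c` on a stencil
`N ⊇ B^k(c₋) ∪ B^k(c₊)` in which `U₀^σ` is η-flat.  THIS FILE moves the (i)-row to that setting with the SAME k-free bracket (cut-off∕transfer):
* §1 letters: ★ `linAvgIterM_congr₂(_of_blocks_subset)` (two-`k`-block locality of the matrix (0.4)-linear average, entrywise from ★w2 g2's `linAvgIter_congr₂`); conjugation algebra;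
  `coe_gaugeAct_expField` (a left perturbation is conjugated at `b₋` by a gauge transformation).
* §2 TRANSFER: for ANY `W_a` agreeing with `(U_a)^σ` on the bonds inside `N`, any `V′` with `V′(c) = V^{σ^{(k)}}(c)`, any `a_N` agreeing with `σ a σ*` inside `N`: `iter_cutoff_eq`
  (★alpha-2 g6's `iter_blockAvg_congr₂_of_blocks_subset`), `norm_defect_cutoff_eq` ∕ `mlog_defect_cutoff_eq` (`NewtonDefectMap`), `linAvgIterM_cutoff_eq`, ★★
  `norm_mlogDefect_sub_sub_framedAvg_le_of_cutoff` — a flat (i)-row for the cut-off quadruple IS the framed (i)-row for the true fields.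
* §3 the rows, cut-offs built inside the proofs (`W := U₀^σ` on the `N`-bonds, `1` elsewhere; `V′ := V^{σ^{(k)}}` at `c`, `Ū_W^{(k)}` elsewhere): ★ `norm_defect_sub_one_le_framed_allL`
  (the defect at `c` stays `ρ_D`-close to `1` in the sup `r`-ball — the regional `Good`) and ★★★ `norm_mlogDefect_sub_sub_framedAvg_le_allL` — `‖Φ(a′)(c) − Φ(a)(c) − T_σ(a′−a)(c)‖ ≤
  (d+1)L^k·[8ρ_D + 2C_A(m′(4r)+m′(2r+η)) + (2r+η) + (2m′(η)+η₀)]·Δ` under the every-`L` flat row's smallness VERBATIM, flatness asked ONLY of `U₀^σ` inside `N`, defect bound ONLY at `c`.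
HONEST FRAMING.  The gauges `σ_c` are INPUTS ((r1-σ)); the approximate right inverse (ii), the shell and the plaquette ledger are NOT here; (FL)∕`hLift`, the stub 2′χ, the crux and any
gap are NOT claimed; count-neutral helper toward R3 2′ (items 19936∕19935); registry untouched; nothing about d = 4, the continuum, or a mass gap; YM₃ on T³ is rung R3, not Clay.

References: T. Bałaban, Commun. Math. Phys. 98 (1985) 17–51 [Balaban1985Averaging] ((11)–(13) p.19, (20)–(23) p.21, Prop. 4 (134)–(135) p.38, Prop. 5 (156)–(157) p.42);
CMP 102 (1985) 277–309 [Balaban1985Variational] ((8), (11)–(15) pp.279–280); CMP 109 (1987) 249–301 [Balaban1987RG1] ((0.4), (0.11) p.253).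
-/

set_option autoImplicit false

noncomputable section

open scoped Matrix.Norms.L2Operator
open NormedSpace
namespace Summit.QuantumFields.YangMills.Theorems.NewtonLiftFramed

open Literature.MathematicalPhysics.QuantumFieldTheory.Balaban1983to89
open Literature.MathematicalPhysics.QuantumFieldTheory.Balaban1983to89.MatrixLog (mlog)
open Literature.MathematicalPhysics.QuantumFieldTheory.Balaban1983to89.B5Eq118OneStroke (iterBlockOf)
open T4Continuum BlockAveraging ExpMeanLog BlockAveragingEMLLinearised
open Summit.QuantumFields.YangMills.Theorems.LinearLiftMatrix (byEntry_apply_re byEntry_apply_im linAvgIterM linAvgIterM_zero linAvgIterM_succ linAvgIterM_eq_byEntry)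
open Summit.QuantumFields.YangMills.Theorems.LinearLiftSpread (linAvgIter_congr₂)
open Summit.QuantumFields.YangMills.Theorems.EMLIterUniformAllL (norm_iter_sub_iter_sub_iterLin_le_uniform_allL)
open Summit.QuantumFields.YangMills.Theorems.NewtonDefectMap (mlog_defect_gaugeAct norm_defect_gaugeAct_sub_one)
open Summit.QuantumFields.YangMills.Theorems.NewtonLiftFlat (norm_mlogDefect_sub_sub_linAvgIterM_le_allL norm_expField_sub_field_le)
open Summit.QuantumFields.YangMills.Theorems.CovLinAvgFrame (coe_gaugeAct)
open Summit.QuantumFields.YangMills.Theorems.PerturbedPlaquette (coe_mul_exp_eq norm_conj_SU)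
open Summit.QuantumFields.YangMills.Theorems.Prop7HolRatioPerStep (coe_star_mul_self coe_mul_star_self)
open Summit.QuantumFields.YangMills.Theorems.AvgIterLocality (iter_blockAvg_congr₂_of_blocks_subset)

variable {n : Type*} [Fintype n] [DecidableEq n] {P : Params}

/-! ## §1 Letters: two-block locality of the matrix linearised average; conjugation algebra -/

/-- **★ THE ITERATED MATRIX (0.4)-LINEAR AVERAGE IS TWO-`s`-BLOCK LOCAL** (standing range): `linAvgIterM s Y c` reads `Y` only on the finest bonds with both ends in `B^s(c₋) ∪ B^s(c₊)`
(entrywise from the scalar `LinearLiftSpread.linAvgIter_congr₂` through `linAvgIterM_eq_byEntry`). [cite: Balaban1987RG1, (0.4)+(0.11) p.253] -/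
theorem linAvgIterM_congr₂ [Nonempty n] {s : ℕ} (hs : s ≤ P.m + P.K) (Y Y' : PBond P 0 → Matrix n n ℂ) (c : PBond P s)
    (h : ∀ b : PBond P 0, (iterBlockOf s b.src = c.src ∨ iterBlockOf s b.src = c.tgt) → (iterBlockOf s b.tgt = c.src ∨ iterBlockOf s b.tgt = c.tgt) → Y b = Y' b) :
    linAvgIterM s Y c = linAvgIterM s Y' c := by
  rw [linAvgIterM_eq_byEntry, linAvgIterM_eq_byEntry]
  ext i l
  apply Complex.ext
  · rw [byEntry_apply_re, byEntry_apply_re]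
    exact linAvgIter_congr₂ _ _ s hs c fun b h1 h2 => by rw [h b h1 h2]
  · rw [byEntry_apply_im, byEntry_apply_im]
    exact linAvgIter_congr₂ _ _ s hs c fun b h1 h2 => by rw [h b h1 h2]

/-- **STENCIL FORM**: agreement of `Y, Y′` on the finest bonds with both ends in ANY set `N ⊇ B^s(c₋) ∪ B^s(c₊)` gives `linAvgIterM s Y c = linAvgIterM s Y′ c`.
[cite: Balaban1987RG1, (0.4)+(0.11) p.253] -/
theorem linAvgIterM_congr₂_of_blocks_subset [Nonempty n] {s : ℕ} (hs : s ≤ P.m + P.K) (N : Set (Site P 0)) (Y Y' : PBond P 0 → Matrix n n ℂ)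
    (hYY' : ∀ b : PBond P 0, b.src ∈ N → b.tgt ∈ N → Y b = Y' b) (c : PBond P s)
    (hc : ∀ x : Site P 0, (iterBlockOf s x = c.src ∨ iterBlockOf s x = c.tgt) → x ∈ N) :
    linAvgIterM s Y c = linAvgIterM s Y' c :=
  linAvgIterM_congr₂ hs Y Y' c fun b hb1 hb2 => hYY' b (hc _ hb1) (hc _ hb2)

/-- Conjugation algebra: `h·(X − h*·L·h)·h* = h·X·h* − L` for `h ∈ SU(n)`. [folklore] -/
theorem conj_sub_conj_mul (h : Matrix.specialUnitaryGroup n ℂ) (X L : Matrix n n ℂ) :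
    (h : Matrix n n ℂ) * (X - star (h : Matrix n n ℂ) * L * (h : Matrix n n ℂ)) * star (h : Matrix n n ℂ) = (h : Matrix n n ℂ) * X * star (h : Matrix n n ℂ) - L := by
  have e : (h : Matrix n n ℂ) * (X - star (h : Matrix n n ℂ) * L * (h : Matrix n n ℂ)) * star (h : Matrix n n ℂ) =
      (h : Matrix n n ℂ) * X * star (h : Matrix n n ℂ) - ((h : Matrix n n ℂ) * star (h : Matrix n n ℂ)) * L * ((h : Matrix n n ℂ) * star (h : Matrix n n ℂ)) := by
    noncomm_ring
  rw [e, coe_mul_star_self, one_mul, mul_one]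

/-- `‖X − h*·L·h‖ = ‖h·X·h* − L‖` for `h ∈ SU(n)` (isometry of conjugation). [cite: Balaban1985Averaging, (19) p.21] -/
theorem norm_sub_conj_eq (h : Matrix.specialUnitaryGroup n ℂ) (X L : Matrix n n ℂ) :
    ‖X - star (h : Matrix n n ℂ) * L * (h : Matrix n n ℂ)‖ = ‖(h : Matrix n n ℂ) * X * star (h : Matrix n n ℂ) - L‖ := by
  rw [← norm_conj_SU h (X - star (h : Matrix n n ℂ) * L * (h : Matrix n n ℂ)), conj_sub_conj_mul]

/-- **A LEFT PERTURBATION IS CONJUGATED AT THE INITIAL POINT BY A GAUGE TRANSFORMATION**: if `U_b = e^{x_b}·U₀,b` then `(U^σ)_b = e^{σ(b₋)x_bσ(b₋)*}·(U₀^σ)_b`.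
[cite: Balaban1985Variational, (15) p.280] -/
theorem coe_gaugeAct_expField [Nonempty n] (σ : GaugeTransf P 0 (Matrix.specialUnitaryGroup n ℂ)) (U₀ U : GaugeField P 0 (Matrix.specialUnitaryGroup n ℂ)) (x : PBond P 0 → Matrix n n ℂ)
    (hU : ∀ b, ((U b : Matrix.specialUnitaryGroup n ℂ) : Matrix n n ℂ) = exp (x b) * (U₀ b : Matrix n n ℂ)) (b : PBond P 0) :
    ((GaugeField.gaugeAct σ U b : Matrix.specialUnitaryGroup n ℂ) : Matrix n n ℂ) =
      exp ((σ b.src : Matrix n n ℂ) * x b * star (σ b.src : Matrix n n ℂ)) * ((GaugeField.gaugeAct σ U₀ b : Matrix.specialUnitaryGroup n ℂ) : Matrix n n ℂ) := by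
  rw [coe_gaugeAct, coe_gaugeAct, hU b]
  calc (σ b.src : Matrix n n ℂ) * (exp (x b) * (U₀ b : Matrix n n ℂ)) * star (σ b.tgt : Matrix n n ℂ)
      = ((σ b.src : Matrix n n ℂ) * exp (x b)) * (U₀ b : Matrix n n ℂ) * star (σ b.tgt : Matrix n n ℂ) := by noncomm_ring
    _ = _ := by rw [coe_mul_exp_eq]; noncomm_ring

/-! ## §2 Transfer through a cut-off in the gauge `σ` -/

section Transfer

variable [Nonempty n] (σ : GaugeTransf P 0 (Matrix.specialUnitaryGroup n ℂ)) (N : Set (Site P 0)) {k : ℕ} (hk : k ≤ P.m + P.K) (c : PBond P k)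
  (hN : ∀ x : Site P 0, (iterBlockOf k x = c.src ∨ iterBlockOf k x = c.tgt) → x ∈ N)
include hk hN

/-- **THE `k`-FOLD AVERAGE AT `c` OF A CUT-OFF OF `U^σ` IS THAT OF `U^σ`** (two-block locality, ★alpha-2 g6). [cite: Balaban1987RG1, (0.4)+(0.11) p.253] -/
theorem iter_cutoff_eq (U W : GaugeField P 0 (Matrix.specialUnitaryGroup n ℂ)) (hW : ∀ b : PBond P 0, b.src ∈ N → b.tgt ∈ N → W b = GaugeField.gaugeAct σ U b) :
    Averaging.iter (fun i => blockAvg (P := P) (j := i) (expMeanLogSU (n := n))) k W c =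
      Averaging.iter (fun i => blockAvg (P := P) (j := i) (expMeanLogSU (n := n))) k (GaugeField.gaugeAct σ U) c :=
  iter_blockAvg_congr₂_of_blocks_subset (expMeanLogSU (n := n)) hk N hW c hN

/-- **THE DEFECT OF THE CUT-OFF PAIR AT `c` HAS THE NORM OF THE TRUE DEFECT**: `‖Ū_W^{(k)}(c)·V′(c)* − 1‖ = ‖Ū^{(k)}(c)·V(c)* − 1‖` when `V′(c) = V^{σ^{(k)}}(c)` (locality + gauge
invariance of the defect's distance to `1`). [cite: Balaban1985Averaging, (11)–(13) p.19, (19) p.21] -/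
theorem norm_defect_cutoff_eq (U W : GaugeField P 0 (Matrix.specialUnitaryGroup n ℂ)) (hW : ∀ b : PBond P 0, b.src ∈ N → b.tgt ∈ N → W b = GaugeField.gaugeAct σ U b)
    (V V' : GaugeField P k (Matrix.specialUnitaryGroup n ℂ)) (hV' : V' c = GaugeField.gaugeAct (transfUp σ k) V c) :
    ‖((Averaging.iter (fun i => blockAvg (P := P) (j := i) (expMeanLogSU (n := n))) k W c : Matrix.specialUnitaryGroup n ℂ) : Matrix n n ℂ) *
        star ((V' c : Matrix.specialUnitaryGroup n ℂ) : Matrix n n ℂ) - 1‖ =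
      ‖((Averaging.iter (fun i => blockAvg (P := P) (j := i) (expMeanLogSU (n := n))) k U c : Matrix.specialUnitaryGroup n ℂ) : Matrix n n ℂ) *
        star ((V c : Matrix.specialUnitaryGroup n ℂ) : Matrix n n ℂ) - 1‖ := by
  rw [iter_cutoff_eq σ N hk c hN U W hW, hV']
  exact norm_defect_gaugeAct_sub_one _ σ hk U V c

/-- **THE LOG-DEFECT OF THE CUT-OFF PAIR AT `c` IS THE CONJUGATED TRUE LOG-DEFECT**: `log(Ū_W^{(k)}(c)·V′(c)*) = h₀·log(Ū^{(k)}(c)·V(c)*)·h₀*`, `h₀ = σ^{(k)}(c₋)`, when the true defect is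
within `1` of the identity. [cite: Balaban1985Averaging, (11)–(13) p.19, (21)–(23) p.21] -/
theorem mlog_defect_cutoff_eq (U W : GaugeField P 0 (Matrix.specialUnitaryGroup n ℂ)) (hW : ∀ b : PBond P 0, b.src ∈ N → b.tgt ∈ N → W b = GaugeField.gaugeAct σ U b)
    (V V' : GaugeField P k (Matrix.specialUnitaryGroup n ℂ)) (hV' : V' c = GaugeField.gaugeAct (transfUp σ k) V c)
    (h1 : ‖((Averaging.iter (fun i => blockAvg (P := P) (j := i) (expMeanLogSU (n := n))) k U c : Matrix.specialUnitaryGroup n ℂ) : Matrix n n ℂ) *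
        star ((V c : Matrix.specialUnitaryGroup n ℂ) : Matrix n n ℂ) - 1‖ < 1) :
    mlog (((Averaging.iter (fun i => blockAvg (P := P) (j := i) (expMeanLogSU (n := n))) k W c : Matrix.specialUnitaryGroup n ℂ) : Matrix n n ℂ) *
        star ((V' c : Matrix.specialUnitaryGroup n ℂ) : Matrix n n ℂ)) =
      (transfUp σ k c.src : Matrix n n ℂ) *
        mlog (((Averaging.iter (fun i => blockAvg (P := P) (j := i) (expMeanLogSU (n := n))) k U c : Matrix.specialUnitaryGroup n ℂ) : Matrix n n ℂ) *
          star ((V c : Matrix.specialUnitaryGroup n ℂ) : Matrix n n ℂ)) * star (transfUp σ k c.src : Matrix n n ℂ) := by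
  rw [iter_cutoff_eq σ N hk c hN U W hW, hV']
  exact mlog_defect_gaugeAct _ σ hk U V c h1

/-- **THE LINEARISED AVERAGE AT `c` OF A CUT-OFF OF `σ a σ*` IS THAT OF `σ a σ*`**. [cite: Balaban1987RG1, (0.4)+(0.11) p.253] -/
theorem linAvgIterM_cutoff_eq (x xN : PBond P 0 → Matrix n n ℂ)
    (hxN : ∀ b : PBond P 0, b.src ∈ N → b.tgt ∈ N → xN b = (σ b.src : Matrix n n ℂ) * x b * star (σ b.src : Matrix n n ℂ)) :
    linAvgIterM k xN c = linAvgIterM k (fun b => (σ b.src : Matrix n n ℂ) * x b * star (σ b.src : Matrix n n ℂ)) c :=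
  linAvgIterM_congr₂_of_blocks_subset hk N xN _ hxN c hN

/-- **★★ TRANSFER: A FLAT (i)-ROW FOR THE CUT-OFF QUADRUPLE IS THE FRAMED (i)-ROW FOR THE TRUE FIELDS.**  Let `W_a, W_{a′}` agree with `(U_a)^σ, (U_{a′})^σ` on the bonds inside `N`,
`V′(c) = V^{σ^{(k)}}(c)`, and let the one-forms `a_N, a′_N` satisfy `a′_N − a_N = σ(a′ − a)σ*` inside `N`; suppose both true defects at `c` are within `1` of the identity.  If
`‖log(Ū_{W′}^{(k)}(c)V′(c)*) − log(Ū_W^{(k)}(c)V′(c)*) − Q^{(k)}(a′_N − a_N)(c)‖ ≤ B` then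
`‖log(Ū_{a′}^{(k)}(c)V(c)*) − log(Ū_a^{(k)}(c)V(c)*) − h₀*·Q^{(k)}(σ(a′ − a)σ*)(c)·h₀‖ ≤ B`, `h₀ = σ^{(k)}(c₋)` — the FRAMED linearisation `T_σ`.
[cite: Balaban1985Averaging, (11)–(13) p.19, (19)–(23) p.21; Balaban1987RG1, (0.4)+(0.11) p.253] -/
theorem norm_mlogDefect_sub_sub_framedAvg_le_of_cutoff (Ua Ua' Wa Wa' : GaugeField P 0 (Matrix.specialUnitaryGroup n ℂ))
    (hWa : ∀ b : PBond P 0, b.src ∈ N → b.tgt ∈ N → Wa b = GaugeField.gaugeAct σ Ua b)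
    (hWa' : ∀ b : PBond P 0, b.src ∈ N → b.tgt ∈ N → Wa' b = GaugeField.gaugeAct σ Ua' b)
    (V V' : GaugeField P k (Matrix.specialUnitaryGroup n ℂ)) (hV' : V' c = GaugeField.gaugeAct (transfUp σ k) V c)
    (a a' aN aN' : PBond P 0 → Matrix n n ℂ)
    (haN : ∀ b : PBond P 0, b.src ∈ N → b.tgt ∈ N → aN' b - aN b = (σ b.src : Matrix n n ℂ) * (a' b - a b) * star (σ b.src : Matrix n n ℂ))
    (h1 : ‖((Averaging.iter (fun i => blockAvg (P := P) (j := i) (expMeanLogSU (n := n))) k Ua c : Matrix.specialUnitaryGroup n ℂ) : Matrix n n ℂ) *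
        star ((V c : Matrix.specialUnitaryGroup n ℂ) : Matrix n n ℂ) - 1‖ < 1)
    (h1' : ‖((Averaging.iter (fun i => blockAvg (P := P) (j := i) (expMeanLogSU (n := n))) k Ua' c : Matrix.specialUnitaryGroup n ℂ) : Matrix n n ℂ) *
        star ((V c : Matrix.specialUnitaryGroup n ℂ) : Matrix n n ℂ) - 1‖ < 1)
    {B : ℝ}
    (hflat : ‖mlog (((Averaging.iter (fun i => blockAvg (P := P) (j := i) (expMeanLogSU (n := n))) k Wa' c : Matrix.specialUnitaryGroup n ℂ) : Matrix n n ℂ) *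
          star ((V' c : Matrix.specialUnitaryGroup n ℂ) : Matrix n n ℂ)) -
        mlog (((Averaging.iter (fun i => blockAvg (P := P) (j := i) (expMeanLogSU (n := n))) k Wa c : Matrix.specialUnitaryGroup n ℂ) : Matrix n n ℂ) *
          star ((V' c : Matrix.specialUnitaryGroup n ℂ) : Matrix n n ℂ)) -
        linAvgIterM k (fun b => aN' b - aN b) c‖ ≤ B) :
    ‖mlog (((Averaging.iter (fun i => blockAvg (P := P) (j := i) (expMeanLogSU (n := n))) k Ua' c : Matrix.specialUnitaryGroup n ℂ) : Matrix n n ℂ) *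
          star ((V c : Matrix.specialUnitaryGroup n ℂ) : Matrix n n ℂ)) -
        mlog (((Averaging.iter (fun i => blockAvg (P := P) (j := i) (expMeanLogSU (n := n))) k Ua c : Matrix.specialUnitaryGroup n ℂ) : Matrix n n ℂ) *
          star ((V c : Matrix.specialUnitaryGroup n ℂ) : Matrix n n ℂ)) -
        star (transfUp σ k c.src : Matrix n n ℂ) *
          linAvgIterM k (fun b => (σ b.src : Matrix n n ℂ) * (a' b - a b) * star (σ b.src : Matrix n n ℂ)) c * (transfUp σ k c.src : Matrix n n ℂ)‖ ≤ B := by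
  have hQ : linAvgIterM k (fun b => aN' b - aN b) c = linAvgIterM k (fun b => (σ b.src : Matrix n n ℂ) * (a' b - a b) * star (σ b.src : Matrix n n ℂ)) c :=
    linAvgIterM_cutoff_eq σ N hk c hN (fun b => a' b - a b) (fun b => aN' b - aN b) haN
  rw [mlog_defect_cutoff_eq σ N hk c hN Ua Wa hWa V V' hV' h1, mlog_defect_cutoff_eq σ N hk c hN Ua' Wa' hWa' V V' hV' h1', hQ] at hflat
  rw [norm_sub_conj_eq]
  have e : ∀ (h Φ' Φ L : Matrix n n ℂ), h * (Φ' - Φ) * star h - L = h * Φ' * star h - h * Φ * star h - L := fun h Φ' Φ L => by noncomm_ring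
  rw [e]
  exact hflat

end Transfer

/-! ## §3 The framed rows: the defect stays near `1` in the ball; hypothesis (i) of the shell with the framed linearisation -/

section Rows

variable [Nonempty n]

/-- **★ THE DEFECT STAYS `ρ_D`-CLOSE TO `1` IN THE BALL, LOCAL-GAUGE FORM** (`k ≤ m + K`, every `L ≥ 2`).  `σ` a finest gauge, `N ⊇ B^k(c₋) ∪ B^k(c₊)` a set of fine sites; `U₀` with
`‖(U₀^σ)_b − 1‖ ≤ η` on the bonds INSIDE `N`; `‖Ū₀^{(k)}(c)·V(c)* − 1‖ ≤ η₀` AT `c`; a perturbation `a` with `‖a_b‖ ≤ r ≤ 1/2`, `U_a = e^{a}U₀`; smallness (`m′(x) = (d+1)L^k x`,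
`C_A = (d+1)C_S·5200ℓ²∕(L(L−1))`): `C_A(m′(2r)+m′(η)) ≤ 1`, `200ℓ(m′(2r)+m′(η)) ≤ 1`, `4ℓ(m′(2r)+m′(η)) < δ_N`.  Then `‖Ū_a^{(k)}(c)·V(c)* − 1‖ ≤ 2m′(2r) + η₀` — the regional `Good`
(gauge invariance of the defect norm + two-block locality + the every-`L` derivative row on the cut-off gauged background).
[cite: Balaban1985Averaging, (11)–(13) p.19, (19) p.21, Prop. 4 (134)–(135) p.38] -/
theorem norm_defect_sub_one_le_framed_allL {k : ℕ} (hk : k ≤ P.m + P.K) (σ : GaugeTransf P 0 (Matrix.specialUnitaryGroup n ℂ)) (N : Set (Site P 0)) (c : PBond P k)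
    (hN : ∀ x : Site P 0, (iterBlockOf k x = c.src ∨ iterBlockOf k x = c.tgt) → x ∈ N)
    (U₀ Ua : GaugeField P 0 (Matrix.specialUnitaryGroup n ℂ)) (V : GaugeField P k (Matrix.specialUnitaryGroup n ℂ)) (a : PBond P 0 → Matrix n n ℂ)
    (hUa : ∀ b, ((Ua b : Matrix.specialUnitaryGroup n ℂ) : Matrix n n ℂ) = exp (a b) * (U₀ b : Matrix n n ℂ))
    {r η η₀ : ℝ} (hr : r ≤ 1 / 2) (hη : 0 ≤ η) (ha : ∀ b, ‖a b‖ ≤ r)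
    (hU₀ : ∀ b : PBond P 0, b.src ∈ N → b.tgt ∈ N → ‖((GaugeField.gaugeAct σ U₀ b : Matrix.specialUnitaryGroup n ℂ) : Matrix n n ℂ) - 1‖ ≤ η)
    (hV : ‖((Averaging.iter (fun i => blockAvg (P := P) (j := i) (expMeanLogSU (n := n))) k U₀ c : Matrix.specialUnitaryGroup n ℂ) : Matrix n n ℂ) *
        star ((V c : Matrix.specialUnitaryGroup n ℂ) : Matrix n n ℂ) - 1‖ ≤ η₀)
    (hm : (((P.d : ℝ) + 1) * ((18 : ℝ) ^ P.d * (2 + ((P.d : ℝ) + 1) * (18 : ℝ) ^ P.d)) * (5200 * (((P.d + 2) * P.L : ℕ) : ℝ) ^ 2) / ((P.L : ℝ) * ((P.L : ℝ) - 1))) *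
      ((((P.d : ℝ) + 1) * (P.L : ℝ) ^ k * (2 * r)) + (((P.d : ℝ) + 1) * (P.L : ℝ) ^ k * η)) ≤ 1)
    (h200 : 200 * (((P.d + 2) * P.L : ℕ) : ℝ) * ((((P.d : ℝ) + 1) * (P.L : ℝ) ^ k * (2 * r)) + (((P.d : ℝ) + 1) * (P.L : ℝ) ^ k * η)) ≤ 1)
    (hNδ : 4 * (((P.d + 2) * P.L : ℕ) : ℝ) * ((((P.d : ℝ) + 1) * (P.L : ℝ) ^ k * (2 * r)) + (((P.d : ℝ) + 1) * (P.L : ℝ) ^ k * η)) < deltaSU n) :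
    ‖((Averaging.iter (fun i => blockAvg (P := P) (j := i) (expMeanLogSU (n := n))) k Ua c : Matrix.specialUnitaryGroup n ℂ) : Matrix n n ℂ) *
        star ((V c : Matrix.specialUnitaryGroup n ℂ) : Matrix n n ℂ) - 1‖ ≤ 2 * (((P.d : ℝ) + 1) * (P.L : ℝ) ^ k * (2 * r)) + η₀ := by
  classical
  set av : (i : ℕ) → Averaging P i (Matrix.specialUnitaryGroup n ℂ) := fun i => blockAvg (P := P) (j := i) (expMeanLogSU (n := n)) with hav
  have hQ0 : ∀ Y : PBond P 0 → Matrix n n ℂ, linAvgIterM 0 Y = Y := fun Y => linAvgIterM_zero Y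
  have hQs : ∀ (i : ℕ) (Y : PBond P 0 → Matrix n n ℂ) (c : PBond P (i + 1)), linAvgIterM (i + 1) Y c = linAvg (linAvgIterM i Y) c :=
    fun i Y c => linAvgIterM_succ i Y c
  have hr0 : 0 ≤ r := (norm_nonneg _).trans (ha ⟨fun _ => 0, c.dir⟩)
  have hr1 : r ≤ 1 := hr.trans (by norm_num)
  have hL1 : (1 : ℝ) < P.L := by exact_mod_cast P.hL.2
  have hLL : 0 < (P.L : ℝ) * ((P.L : ℝ) - 1) := mul_pos (by linarith) (by linarith)
  have hCA0 : 0 ≤ (((P.d : ℝ) + 1) * ((18 : ℝ) ^ P.d * (2 + ((P.d : ℝ) + 1) * (18 : ℝ) ^ P.d)) * (5200 * (((P.d + 2) * P.L : ℕ) : ℝ) ^ 2) / ((P.L : ℝ) * ((P.L : ℝ) - 1))) :=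
    div_nonneg (by positivity) hLL.le
  have hmη0 : 0 ≤ ((P.d : ℝ) + 1) * (P.L : ℝ) ^ k * η := by positivity
  -- the cut-off gauged background and perturbed field
  let InN : PBond P 0 → Prop := fun b => b.src ∈ N ∧ b.tgt ∈ N
  let W : GaugeField P 0 (Matrix.specialUnitaryGroup n ℂ) := fun b => if InN b then GaugeField.gaugeAct σ U₀ b else 1
  let Wa : GaugeField P 0 (Matrix.specialUnitaryGroup n ℂ) := fun b => if InN b then GaugeField.gaugeAct σ Ua b else 1
  have hW_in : ∀ b : PBond P 0, b.src ∈ N → b.tgt ∈ N → W b = GaugeField.gaugeAct σ U₀ b := fun b h1 h2 => if_pos ⟨h1, h2⟩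
  have hWa_in : ∀ b : PBond P 0, b.src ∈ N → b.tgt ∈ N → Wa b = GaugeField.gaugeAct σ Ua b := fun b h1 h2 => if_pos ⟨h1, h2⟩
  -- global sizes of the cut-offs
  have hW_one : ∀ b, ‖((W b : Matrix.specialUnitaryGroup n ℂ) : Matrix n n ℂ) - 1‖ ≤ η := by
    intro b
    by_cases hb : InN b
    · have e : W b = GaugeField.gaugeAct σ U₀ b := if_pos hb
      rw [e]; exact hU₀ b hb.1 hb.2
    · have e : W b = 1 := if_neg hb
      rw [e]; simpa using hη
  have hWa_W : ∀ b, ‖((Wa b : Matrix.specialUnitaryGroup n ℂ) : Matrix n n ℂ) - ((W b : Matrix.specialUnitaryGroup n ℂ) : Matrix n n ℂ)‖ ≤ 2 * r := by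
    intro b
    by_cases hb : InN b
    · have e : W b = GaugeField.gaugeAct σ U₀ b := if_pos hb
      have e' : Wa b = GaugeField.gaugeAct σ Ua b := if_pos hb
      rw [e, e', coe_gaugeAct_expField σ U₀ Ua a hUa b]
      exact norm_expField_sub_field_le (GaugeField.gaugeAct σ U₀ b) _ hr1 (by rw [norm_conj_SU]; exact ha b)
    · have e : W b = 1 := if_neg hb
      have e' : Wa b = 1 := if_neg hb
      rw [e, e', sub_self, norm_zero]; positivity
  -- R3 on the cut-offs, at `c`
  have hR3 := norm_iter_sub_iter_sub_iterLin_le_uniform_allL linAvgIterM hQ0 hQs Wa W hη (by positivity) hW_one hWa_W k hk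
    (by
      have h1 : (((P.d : ℝ) + 1) * ((18 : ℝ) ^ P.d * (2 + ((P.d : ℝ) + 1) * (18 : ℝ) ^ P.d)) * (324 * (((P.d + 2) * P.L : ℕ) : ℝ) ^ 2) / ((P.L : ℝ) * ((P.L : ℝ) - 1))) ≤
          (((P.d : ℝ) + 1) * ((18 : ℝ) ^ P.d * (2 + ((P.d : ℝ) + 1) * (18 : ℝ) ^ P.d)) * (5200 * (((P.d + 2) * P.L : ℕ) : ℝ) ^ 2) / ((P.L : ℝ) * ((P.L : ℝ) - 1))) :=
        div_le_div_of_nonneg_right (by gcongr; norm_num) hLL.le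
      have h2 : ((P.d : ℝ) + 1) * (P.L : ℝ) ^ k * η ≤ (((P.d : ℝ) + 1) * (P.L : ℝ) ^ k * (2 * r)) + (((P.d : ℝ) + 1) * (P.L : ℝ) ^ k * η) := le_add_of_nonneg_left (by positivity)
      exact (mul_le_mul h1 h2 hmη0 hCA0).trans hm)
    h200 hm hNδ
  obtain ⟨hWW, -⟩ := hR3 k le_rfl c
  -- the datum of the cut-off pair
  let V' : GaugeField P k (Matrix.specialUnitaryGroup n ℂ) := fun c' => if c' = c then GaugeField.gaugeAct (transfUp σ k) V c else Averaging.iter av k W c'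
  have hV'c : V' c = GaugeField.gaugeAct (transfUp σ k) V c := if_pos rfl
  -- transfer
  rw [← norm_defect_cutoff_eq σ N hk c hN Ua Wa hWa_in V V' hV'c]
  have h0 : ‖((Averaging.iter av k W c : Matrix.specialUnitaryGroup n ℂ) : Matrix n n ℂ) * star ((V' c : Matrix.specialUnitaryGroup n ℂ) : Matrix n n ℂ) - 1‖ ≤ η₀ := by
    rw [norm_defect_cutoff_eq σ N hk c hN U₀ W hW_in V V' hV'c]; exact hV
  set X := ((Averaging.iter av k Wa c : Matrix.specialUnitaryGroup n ℂ) : Matrix n n ℂ) with hX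
  set X₀ := ((Averaging.iter av k W c : Matrix.specialUnitaryGroup n ℂ) : Matrix n n ℂ) with hX₀
  set sV := star ((V' c : Matrix.specialUnitaryGroup n ℂ) : Matrix n n ℂ) with hsV
  have e : X * sV - 1 = (X - X₀) * sV + (X₀ * sV - 1) := by noncomm_ring
  show ‖X * sV - 1‖ ≤ _
  rw [e]
  calc _ ≤ ‖(X - X₀) * sV‖ + ‖X₀ * sV - 1‖ := norm_add_le _ _
    _ ≤ 2 * (((P.d : ℝ) + 1) * (P.L : ℝ) ^ k * (2 * r)) + η₀ := by
        rw [hsV, CStarRing.norm_mul_mem_unitary _ (Unitary.star_mem (V' c).2.1)]; exact add_le_add hWW h0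

/-- **★★★ HYPOTHESIS (i) OF THE NEWTON SHELL IN A LOCAL GAUGE, AT EVERY `L ≥ 2`** (`k ≤ m + K`).  `σ` ANY finest gauge transformation, `N ⊇ B^k(c₋) ∪ B^k(c₊)` ANY set of fine sites;
`U₀` a finest `SU(n)` field with `‖(U₀^σ)_b − 1‖ ≤ η` on the bonds with both ends in `N` (flat IN THE GAUGE `σ` ON THE STENCIL only); `V` a level-`k` field with
`‖Ū₀^{(k)}(c)·V(c)* − 1‖ ≤ η₀` AT `c`; perturbations `a, a′` with `‖a_b‖, ‖a′_b‖ ≤ r ≤ 1/2`, `‖a′_b − a_b‖ ≤ Δ ≤ 2r`, `U_a = e^{a}U₀`, `U_{a′} = e^{a′}U₀`; the smallness rows of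
`NewtonLiftFlat.norm_mlogDefect_sub_sub_linAvgIterM_le_allL` VERBATIM (`m′(x) = (d+1)L^k x`, `C_A = (d+1)C_S·5200ℓ²∕(L(L−1))`: `C_A(m′(4r)+m′(2r+η)) ≤ 1`, `200ℓ(…) ≤ 1`, `4ℓ(…) < δ_N`,
`ρ_D = 2m′(2r) + η₀ ≤ 1/2`).  THEN
`‖log(Ū_{a′}^{(k)}(c)V(c)*) − log(Ū_a^{(k)}(c)V(c)*) − h₀*·Q^{(k)}(σ(a′ − a)σ*)(c)·h₀‖ ≤ (d+1)L^k·[8ρ_D + 2C_A(m′(4r)+m′(2r+η)) + (2r+η) + (2m′(η)+η₀)]·Δ`, `h₀ = σ^{(k)}(c₋)` — the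
(i)-row of `NewtonShell.exists_zero_on_support_of_approxRightInverse` at the constrained bond `c` for the FRAMED linearisation `T_σ(a)(c) = h₀*·Q^{(k)}(σ a σ*)(c)·h₀`, SAME k-free
bracket as the flat row.  Proof: the flat row on the cut-off quadruple (`W_• := (U_•)^σ` on the `N`-bonds, `1` elsewhere; `a_N := σ a σ*` there, `0` elsewhere; `V′`) + §2 transfer.
[cite: Balaban1985Averaging, (11)–(13) p.19, (20)–(23) p.21, Prop. 4 (134)–(135) p.38, Prop. 5 (156)–(157) p.42; Balaban1985Variational, (15) p.280] -/
theorem norm_mlogDefect_sub_sub_framedAvg_le_allL {k : ℕ} (hk : k ≤ P.m + P.K) (σ : GaugeTransf P 0 (Matrix.specialUnitaryGroup n ℂ)) (N : Set (Site P 0)) (c : PBond P k)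
    (hN : ∀ x : Site P 0, (iterBlockOf k x = c.src ∨ iterBlockOf k x = c.tgt) → x ∈ N)
    (U₀ Ua Ua' : GaugeField P 0 (Matrix.specialUnitaryGroup n ℂ)) (V : GaugeField P k (Matrix.specialUnitaryGroup n ℂ)) (a a' : PBond P 0 → Matrix n n ℂ)
    (hUa : ∀ b, ((Ua b : Matrix.specialUnitaryGroup n ℂ) : Matrix n n ℂ) = exp (a b) * (U₀ b : Matrix n n ℂ))
    (hUa' : ∀ b, ((Ua' b : Matrix.specialUnitaryGroup n ℂ) : Matrix n n ℂ) = exp (a' b) * (U₀ b : Matrix n n ℂ))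
    {r η η₀ Δ : ℝ} (hr : r ≤ 1 / 2) (hη : 0 ≤ η) (hη₀ : 0 ≤ η₀) (hΔr : Δ ≤ 2 * r)
    (ha : ∀ b, ‖a b‖ ≤ r) (ha' : ∀ b, ‖a' b‖ ≤ r) (hΔ : ∀ b, ‖a' b - a b‖ ≤ Δ)
    (hU₀ : ∀ b : PBond P 0, b.src ∈ N → b.tgt ∈ N → ‖((GaugeField.gaugeAct σ U₀ b : Matrix.specialUnitaryGroup n ℂ) : Matrix n n ℂ) - 1‖ ≤ η)
    (hV : ‖((Averaging.iter (fun i => blockAvg (P := P) (j := i) (expMeanLogSU (n := n))) k U₀ c : Matrix.specialUnitaryGroup n ℂ) : Matrix n n ℂ) *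
        star ((V c : Matrix.specialUnitaryGroup n ℂ) : Matrix n n ℂ) - 1‖ ≤ η₀)
    (h5200 : (((P.d : ℝ) + 1) * ((18 : ℝ) ^ P.d * (2 + ((P.d : ℝ) + 1) * (18 : ℝ) ^ P.d)) * (5200 * (((P.d + 2) * P.L : ℕ) : ℝ) ^ 2) / ((P.L : ℝ) * ((P.L : ℝ) - 1))) *
      ((((P.d : ℝ) + 1) * (P.L : ℝ) ^ k * (4 * r)) + (((P.d : ℝ) + 1) * (P.L : ℝ) ^ k * (2 * r + η))) ≤ 1)
    (h200 : 200 * (((P.d + 2) * P.L : ℕ) : ℝ) * ((((P.d : ℝ) + 1) * (P.L : ℝ) ^ k * (4 * r)) + (((P.d : ℝ) + 1) * (P.L : ℝ) ^ k * (2 * r + η))) ≤ 1)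
    (hNδ : 4 * (((P.d + 2) * P.L : ℕ) : ℝ) *
      ((((P.d : ℝ) + 1) * (P.L : ℝ) ^ k * (4 * r)) + (((P.d : ℝ) + 1) * (P.L : ℝ) ^ k * (2 * r + η))) < deltaSU n)
    (hρD : 2 * ((((P.d : ℝ) + 1) * (P.L : ℝ) ^ k * (2 * r))) + η₀ ≤ 1 / 2) :
    ‖mlog (((Averaging.iter (fun i => blockAvg (P := P) (j := i) (expMeanLogSU (n := n))) k Ua' c : Matrix.specialUnitaryGroup n ℂ) : Matrix n n ℂ) *
          star ((V c : Matrix.specialUnitaryGroup n ℂ) : Matrix n n ℂ)) -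
        mlog (((Averaging.iter (fun i => blockAvg (P := P) (j := i) (expMeanLogSU (n := n))) k Ua c : Matrix.specialUnitaryGroup n ℂ) : Matrix n n ℂ) *
          star ((V c : Matrix.specialUnitaryGroup n ℂ) : Matrix n n ℂ)) -
        star (transfUp σ k c.src : Matrix n n ℂ) *
          linAvgIterM k (fun b => (σ b.src : Matrix n n ℂ) * (a' b - a b) * star (σ b.src : Matrix n n ℂ)) c * (transfUp σ k c.src : Matrix n n ℂ)‖ ≤
      (((P.d : ℝ) + 1) * (P.L : ℝ) ^ k) *
        (8 * (2 * ((((P.d : ℝ) + 1) * (P.L : ℝ) ^ k * (2 * r))) + η₀) +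
          2 * (((P.d : ℝ) + 1) * ((18 : ℝ) ^ P.d * (2 + ((P.d : ℝ) + 1) * (18 : ℝ) ^ P.d)) * (5200 * (((P.d + 2) * P.L : ℕ) : ℝ) ^ 2) / ((P.L : ℝ) * ((P.L : ℝ) - 1))) *
            ((((P.d : ℝ) + 1) * (P.L : ℝ) ^ k * (4 * r)) + (((P.d : ℝ) + 1) * (P.L : ℝ) ^ k * (2 * r + η))) +
          (2 * r + η) + (2 * ((((P.d : ℝ) + 1) * (P.L : ℝ) ^ k * η)) + η₀)) * Δ := by
  classical
  set av : (i : ℕ) → Averaging P i (Matrix.specialUnitaryGroup n ℂ) := fun i => blockAvg (P := P) (j := i) (expMeanLogSU (n := n)) with hav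
  have hr0 : 0 ≤ r := (norm_nonneg _).trans (ha ⟨fun _ => 0, c.dir⟩)
  have hΔ0 : 0 ≤ Δ := (norm_nonneg _).trans (hΔ ⟨fun _ => 0, c.dir⟩)
  have hL1 : (1 : ℝ) < P.L := by exact_mod_cast P.hL.2
  have hLL : 0 < (P.L : ℝ) * ((P.L : ℝ) - 1) := mul_pos (by linarith) (by linarith)
  have hCA0 : 0 ≤ (((P.d : ℝ) + 1) * ((18 : ℝ) ^ P.d * (2 + ((P.d : ℝ) + 1) * (18 : ℝ) ^ P.d)) * (5200 * (((P.d + 2) * P.L : ℕ) : ℝ) ^ 2) / ((P.L : ℝ) * ((P.L : ℝ) - 1))) :=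
    div_nonneg (by positivity) hLL.le
  have hA0 : 0 ≤ ((P.d : ℝ) + 1) * (P.L : ℝ) ^ k := by positivity
  have hmono : (((P.d : ℝ) + 1) * (P.L : ℝ) ^ k * (2 * r)) + (((P.d : ℝ) + 1) * (P.L : ℝ) ^ k * η) ≤
      (((P.d : ℝ) + 1) * (P.L : ℝ) ^ k * (4 * r)) + (((P.d : ℝ) + 1) * (P.L : ℝ) ^ k * (2 * r + η)) := by nlinarith [mul_nonneg hA0 hr0]
  have hsum0 : 0 ≤ (((P.d : ℝ) + 1) * (P.L : ℝ) ^ k * (2 * r)) + (((P.d : ℝ) + 1) * (P.L : ℝ) ^ k * η) := by positivity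
  have hm' := (mul_le_mul_of_nonneg_left hmono hCA0).trans h5200
  have h200' := (mul_le_mul_of_nonneg_left hmono (by positivity : (0 : ℝ) ≤ 200 * (((P.d + 2) * P.L : ℕ) : ℝ))).trans h200
  have hNδ' := lt_of_le_of_lt (mul_le_mul_of_nonneg_left hmono (by positivity : (0 : ℝ) ≤ 4 * (((P.d + 2) * P.L : ℕ) : ℝ))) hNδ
  -- the cut-offs
  let InN : PBond P 0 → Prop := fun b => b.src ∈ N ∧ b.tgt ∈ N
  let W : GaugeField P 0 (Matrix.specialUnitaryGroup n ℂ) := fun b => if InN b then GaugeField.gaugeAct σ U₀ b else 1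
  let Wa : GaugeField P 0 (Matrix.specialUnitaryGroup n ℂ) := fun b => if InN b then GaugeField.gaugeAct σ Ua b else 1
  let Wa' : GaugeField P 0 (Matrix.specialUnitaryGroup n ℂ) := fun b => if InN b then GaugeField.gaugeAct σ Ua' b else 1
  let aN : PBond P 0 → Matrix n n ℂ := fun b => if InN b then (σ b.src : Matrix n n ℂ) * a b * star (σ b.src : Matrix n n ℂ) else 0
  let aN' : PBond P 0 → Matrix n n ℂ := fun b => if InN b then (σ b.src : Matrix n n ℂ) * a' b * star (σ b.src : Matrix n n ℂ) else 0
  let V' : GaugeField P k (Matrix.specialUnitaryGroup n ℂ) := fun c' => if c' = c then GaugeField.gaugeAct (transfUp σ k) V c else Averaging.iter av k W c'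
  have hW_in : ∀ b : PBond P 0, b.src ∈ N → b.tgt ∈ N → W b = GaugeField.gaugeAct σ U₀ b := fun b h1 h2 => if_pos ⟨h1, h2⟩
  have hWa_in : ∀ b : PBond P 0, b.src ∈ N → b.tgt ∈ N → Wa b = GaugeField.gaugeAct σ Ua b := fun b h1 h2 => if_pos ⟨h1, h2⟩
  have hWa'_in : ∀ b : PBond P 0, b.src ∈ N → b.tgt ∈ N → Wa' b = GaugeField.gaugeAct σ Ua' b := fun b h1 h2 => if_pos ⟨h1, h2⟩
  have hV'c : V' c = GaugeField.gaugeAct (transfUp σ k) V c := if_pos rfl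
  have hdiff_in : ∀ b : PBond P 0, b.src ∈ N → b.tgt ∈ N → aN' b - aN b = (σ b.src : Matrix n n ℂ) * (a' b - a b) * star (σ b.src : Matrix n n ℂ) := by
    intro b h1 h2
    have e : aN b = (σ b.src : Matrix n n ℂ) * a b * star (σ b.src : Matrix n n ℂ) := if_pos ⟨h1, h2⟩
    have e' : aN' b = (σ b.src : Matrix n n ℂ) * a' b * star (σ b.src : Matrix n n ℂ) := if_pos ⟨h1, h2⟩
    rw [e, e']; noncomm_ring
  -- the exponential form of the cut-off perturbed fields
  have hexp : ∀ (Ub : GaugeField P 0 (Matrix.specialUnitaryGroup n ℂ)) (x : PBond P 0 → Matrix n n ℂ),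
      (∀ b, ((Ub b : Matrix.specialUnitaryGroup n ℂ) : Matrix n n ℂ) = exp (x b) * (U₀ b : Matrix n n ℂ)) →
      ∀ b, (((if InN b then GaugeField.gaugeAct σ Ub b else 1 : Matrix.specialUnitaryGroup n ℂ)) : Matrix n n ℂ) =
        exp (if InN b then (σ b.src : Matrix n n ℂ) * x b * star (σ b.src : Matrix n n ℂ) else 0) * ((W b : Matrix.specialUnitaryGroup n ℂ) : Matrix n n ℂ) := by
    intro Ub x hUb b
    by_cases hb : InN b
    · have e : W b = GaugeField.gaugeAct σ U₀ b := if_pos hb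
      rw [if_pos hb, if_pos hb, e]; exact coe_gaugeAct_expField σ U₀ Ub x hUb b
    · have e : W b = 1 := if_neg hb
      rw [if_neg hb, if_neg hb, e, exp_zero, one_mul]
  have hWa_exp : ∀ b, ((Wa b : Matrix.specialUnitaryGroup n ℂ) : Matrix n n ℂ) = exp (aN b) * (W b : Matrix n n ℂ) := hexp Ua a hUa
  have hWa'_exp : ∀ b, ((Wa' b : Matrix.specialUnitaryGroup n ℂ) : Matrix n n ℂ) = exp (aN' b) * (W b : Matrix n n ℂ) := hexp Ua' a' hUa'
  -- sizes of the cut-off perturbations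
  have hsize : ∀ (x : PBond P 0 → Matrix n n ℂ) {s : ℝ}, 0 ≤ s → (∀ b, ‖x b‖ ≤ s) →
      ∀ b, ‖(if InN b then (σ b.src : Matrix n n ℂ) * x b * star (σ b.src : Matrix n n ℂ) else 0 : Matrix n n ℂ)‖ ≤ s := by
    intro x s hs hx b
    by_cases hb : InN b
    · rw [if_pos hb, norm_conj_SU]; exact hx b
    · rw [if_neg hb, norm_zero]; exact hs
  have haN : ∀ b, ‖aN b‖ ≤ r := hsize a hr0 ha
  have haN' : ∀ b, ‖aN' b‖ ≤ r := hsize a' hr0 ha'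
  have hΔN : ∀ b, ‖aN' b - aN b‖ ≤ Δ := by
    intro b
    by_cases hb : InN b
    · rw [hdiff_in b hb.1 hb.2, norm_conj_SU]; exact hΔ b
    · have e : aN b = 0 := if_neg hb
      have e' : aN' b = 0 := if_neg hb
      rw [e, e', sub_zero, norm_zero]; exact hΔ0
  -- the cut-off background is flat on the whole torus
  have hW_one : ∀ b, ‖((W b : Matrix.specialUnitaryGroup n ℂ) : Matrix n n ℂ) - 1‖ ≤ η := by
    intro b
    by_cases hb : InN b
    · have e : W b = GaugeField.gaugeAct σ U₀ b := if_pos hb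
      rw [e]; exact hU₀ b hb.1 hb.2
    · have e : W b = 1 := if_neg hb
      rw [e]; simpa using hη
  -- the cut-off datum: defect `η₀` at `c`, `0` elsewhere
  have hV'all : ∀ c' : PBond P k, ‖((Averaging.iter av k W c' : Matrix.specialUnitaryGroup n ℂ) : Matrix n n ℂ) * star ((V' c' : Matrix.specialUnitaryGroup n ℂ) : Matrix n n ℂ) - 1‖ ≤ η₀ := by
    intro c'
    by_cases hc : c' = c
    · subst hc
      rw [norm_defect_cutoff_eq σ N hk _ hN U₀ W hW_in V V' hV'c]; exact hV
    · have e : V' c' = Averaging.iter av k W c' := if_neg hc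
      rw [e, coe_mul_star_self, sub_self, norm_zero]; exact hη₀
  -- the flat row on the cut-off quadruple
  have hflat := norm_mlogDefect_sub_sub_linAvgIterM_le_allL hk W Wa Wa' V' aN aN' hWa_exp hWa'_exp hr hη hη₀ hΔr haN haN' hΔN hW_one hV'all h5200 h200 hNδ hρD c
  -- the true defects stay within `1` of the identity
  have hρD1 : 2 * ((((P.d : ℝ) + 1) * (P.L : ℝ) ^ k * (2 * r))) + η₀ < 1 := lt_of_le_of_lt hρD (by norm_num)
  have h1 := lt_of_le_of_lt (norm_defect_sub_one_le_framed_allL hk σ N c hN U₀ Ua V a hUa hr hη ha hU₀ hV hm' h200' hNδ') hρD1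
  have h1' := lt_of_le_of_lt (norm_defect_sub_one_le_framed_allL hk σ N c hN U₀ Ua' V a' hUa' hr hη ha' hU₀ hV hm' h200' hNδ') hρD1
  -- transfer
  exact norm_mlogDefect_sub_sub_framedAvg_le_of_cutoff σ N hk c hN Ua Ua' Wa Wa' hWa_in hWa'_in V V' hV'c a a' aN aN' hdiff_in h1 h1' hflat

end Rows

end Summit.QuantumFields.YangMills.Theorems.NewtonLiftFramed

end
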